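import Literature.Analysis.FluidPDE.PineauVicolProfileTimeDerivativeDecay
import HarnessLib

/-!
# Pineau–Vicol 2026, proof of Lemma 8.1, third display: the SECOND time derivative of the profile,
# `|∂²ₛU(y,s)| ≤ C_{U,s}(1+|α|)²/(1+|y|)`, for a jointly smooth family solving the rotated profile
# equation with `P = RᵢRⱼ(UᵢUⱼ)` — WITHOUT periodicity

Analysis/FluidPDE proofs file (theorems only; **no definitions, no named facts**).  B. Pineau,
V. Vicol, *On rotated backwards self-similar solutions of the incompressible 3D Navier–Stokes
equations*, arXiv:2607.09619v2 (2026), §8, proof of Lemma 8.1, p. 28: "However, by applying `∂ₛ` to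
(1.14a) and using the above bounds, along with (8.3), we obtain
`|∂²ₛU(y, s)| ≤ C_{U,s}(1 + |α|)²/(1 + |y|)` …".  The tree's
`PineauVicol2026.exists_norm_sliceDeriv_le_of_periodic` (`PineauVicolProfileTimeDerivativeDecay.lean`)
proves this display INSIDE the proof of (8.2) and then closes with Poincaré in `s`, which is the only
place where the `S`-periodicity of the family is used.  This file records the display itself, for an
arbitrary (not necessarily periodic) jointly smooth family:

* `exists_norm_sliceDeriv2_le (C)` — there is `C_a = C_a(C) ≥ 0` such that for every jointly `C^∞`
  family `U : ℝ → ℝ³ → ℝ³` obeying (8.3) uniformly in `s` up to order `6` with constant `C`, with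
  `V = ∂ₛU`, `W = ∂ₛV = ∂²ₛU`, whose slices solve
  `α𝓡U + ½U + ½DU[y] − ΔU + (U·∇)U + ∇Q[U(s)] + ∂ₛU = 0`, one has
  `|∂²ₛU(y,s)| ≤ C_a (1+|α|)²/(1+|y|)` for all `(y, s)`.

The proof is VERBATIM the tree's assembly (first display at `k ≤ 3`, (8.3) for `P`, the second
display at `k = 1` for `∂ₛP = 2Qˢ[∂ₛU,U]`, `∂ₛ` applied to (1.14a), the third display at `k = 0` via
`norm_sliceDeriv2_le_of_dslice_equation`), with the Poincaré step removed; nothing accepted is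
restated or changed.  Consumer: the `α = 0` case is the ACCELERATION BOUND `‖∂ₛ²U‖ ≤ B(C₀)` of the
Type-I envelope class used by the rung line `flat_window` of `Summits/NavierStokesRegularity`
(crux `QuarterLogPincer.TypeIQuantSubcubicExp`).  DEVIATION from the print, as in the tree's (8.2):
`C_a` depends on the common (8.3) constant `C` for the orders `j ≤ 6`.

## Mathlib / tree search

`lean search 'sliceDeriv2|norm_sliceDeriv2_le'`: only `norm_sliceDeriv2_le_of_dslice_equation` (the
pointwise third display from explicit bounds, `PineauVicolSliceDerivativeBounds.lean`) and its use
inside `exists_norm_sliceDeriv_le_of_periodic` (2026-08-28); no periodicity-free packaged form.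

## References

* B. Pineau, V. Vicol, arXiv:2607.09619v2 (2026): §8, Lemma 8.1, proof (p. 28), third display;
  (1.14a) (p. 7); Lemma 2.1 (pp. 9–10). [PineauVicol2026]
-/

noncomputable section

open MeasureTheory Set Filter Metric Topology InnerProductSpace Function
open scoped RealInnerProductSpace Laplacian ContDiff ENNReal

namespace Literature.Analysis.FluidPDE

namespace PineauVicol2026

section SecondDerivative

/-- Elementary weight comparison `1 + a^2 ≤ (1 + a)^2` for `a ≥ 0`. [folklore] -/
private theorem one_add_sq_le_sq_one_add {a : ℝ} (ha : 0 ≤ a) : 1 + a ^ 2 ≤ (1 + a) ^ 2 := by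
  nlinarith

/-- Elementary weight comparison `1 + a^3 ≤ (1 + a)^3` for `a ≥ 0`. [folklore] -/
private theorem one_add_cube_le_cube_one_add {a : ℝ} (ha : 0 ≤ a) : 1 + a ^ 3 ≤ (1 + a) ^ 3 := by
  nlinarith [sq_nonneg a, mul_nonneg ha (sq_nonneg a)]

/-- `c/(1+a)^m ≤ c` for `c, a ≥ 0`. [folklore] -/
private theorem div_one_add_pow_le_self {c a : ℝ} (hc : 0 ≤ c) (ha : 0 ≤ a) (m : ℕ) :
    c / (1 + a) ^ m ≤ c :=
  div_le_self hc (one_le_pow₀ (by linarith))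

/-- Weighted form to quotient form. [folklore] -/
private theorem le_div_of_weighted {t w c : ℝ} (hw : 0 < w) (h : w * t ≤ c) : t ≤ c / w := by
  rw [le_div_iff₀ hw, mul_comm]; exact h

/-- Quotient form to weighted form. [folklore] -/
private theorem weighted_of_le_div {t w c : ℝ} (hw : 0 < w) (h : t ≤ c / w) : w * t ≤ c := by
  rw [le_div_iff₀ hw, mul_comm] at h; exact h

/-- **Pineau–Vicol 2026, proof of Lemma 8.1, third display (no periodicity).** There is
`C_a = C_a(C) ≥ 0` such that: if `U : ℝ → ℝ³ → ℝ³` is jointly `C^∞`, obeys (8.3) uniformly in `s` up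
to order `6` with constant `C` (`(1+|y|)^{j+1}|DʲU(s,·)(y)| ≤ C`, `j ≤ 6`), `V = ∂ₛU`, `W = ∂ₛV`,
and every slice solves `α𝓡U + ½U + ½DU[y] − ΔU + (U·∇)U + ∇Q[U(s)] + ∂ₛU = 0`, then
`|∂²ₛU(y,s)| ≤ C_a (1+|α|)²/(1+|y|)` for all `(y,s)`.  Verbatim the assembly inside the tree's
`exists_norm_sliceDeriv_le_of_periodic` up to its Poincaré step.
[cite: PineauVicol2026, Lemma 8.1, proof (p. 28), third display] -/
theorem exists_norm_sliceDeriv2_le (C : ℝ) :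
    ∃ Ca : ℝ, 0 ≤ Ca ∧ ∀ (U V W : ℝ → EuclideanSpace ℝ (Fin 3) → EuclideanSpace ℝ (Fin 3)) (α : ℝ),
      IsSmoothSpaceTimeOn Set.univ U →
      (V = fun σ y => deriv (fun τ => U τ y) σ) → (W = fun σ y => deriv (fun τ => V τ y) σ) →
      (∀ σ, ∀ j ≤ 6, ∀ y, (1 + ‖y‖) ^ (j + 1) * ‖iteratedFDeriv ℝ j (U σ) y‖ ≤ C) →
      (∀ σ y, α • (rotGen (U σ y) - fderiv ℝ (U σ) y (rotGen y)) + (1 / 2 : ℝ) • U σ y +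
        (1 / 2 : ℝ) • fderiv ℝ (U σ) y y - (Δ (U σ)) y + convect (U σ) (U σ) y +
          gradient (pressurePotential (U σ)) y + V σ y = 0) →
      ∀ σ y, ‖W σ y‖ ≤ Ca * (1 + |α|) ^ 2 / (1 + ‖y‖) := by
  obtain ⟨A₁, hA₁0, hA₁⟩ := exists_bound_norm_iteratedFDeriv_pressurePotential_decay 1
  obtain ⟨A₂, hA₂0, hA₂⟩ := exists_bound_norm_iteratedFDeriv_pressurePotential_decay 2
  obtain ⟨A₃, hA₃0, hA₃⟩ := exists_bound_norm_iteratedFDeriv_pressurePotential_decay 3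
  obtain ⟨A₄, hA₄0, hA₄⟩ := exists_bound_norm_iteratedFDeriv_pressurePotential_decay 4
  obtain ⟨B₁, hB₁0, hB₁⟩ := exists_bound_norm_fderiv_pressurePotentialSym_decay
  -- the constants of the first display at orders 0..3 (without the factor `1+|α|`)
  obtain ⟨e₀, he₀⟩ : ∃ e : ℝ, e = (2 ^ 0 + 4) * C + 2 ^ 0 * C ^ 2 + A₁ * C ^ 2 := ⟨_, rfl⟩
  obtain ⟨e₁, he₁⟩ : ∃ e : ℝ, e = (2 ^ 1 + 4) * C + 2 ^ 1 * C ^ 2 + A₂ * C ^ 2 := ⟨_, rfl⟩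
  obtain ⟨e₂, he₂⟩ : ∃ e : ℝ, e = (2 ^ 2 + 4) * C + 2 ^ 2 * C ^ 2 + A₃ * C ^ 2 := ⟨_, rfl⟩
  obtain ⟨e₃, he₃⟩ : ∃ e : ℝ, e = (2 ^ 3 + 4) * C + 2 ^ 3 * C ^ 2 + A₄ * C ^ 2 := ⟨_, rfl⟩
  -- the constant is stated for `max C 0` so that its nonnegativity is unconditional
  by_cases hCneg : C < 0
  · -- (8.3) at order `0`, `y = 0` forces `0 ≤ C`: the hypotheses are contradictory
    refine ⟨0, le_rfl, fun U V W α hU hV hW h83 heq σ y => ?_⟩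
    have h := h83 0 0 (by norm_num) 0
    rw [pow_one] at h
    exact absurd (le_trans (by positivity) h) (not_le.2 hCneg)
  have hC0 : 0 ≤ C := not_lt.1 hCneg
  have he₀0 : 0 ≤ e₀ := by rw [he₀]; positivity
  have he₁0 : 0 ≤ e₁ := by rw [he₁]; positivity
  have he₂0 : 0 ≤ e₂ := by rw [he₂]; positivity
  have he₃0 : 0 ≤ e₃ := by rw [he₃]; positivity
  refine ⟨e₀ + 2 * e₁ + 6 * e₂ + C * e₀ + C * e₁ + 2 * B₁ * (e₀ + e₁ + e₂ + e₃) * C, by positivity, ?_⟩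
  intro U V W α hU hV hW h83 heq
  have ha : 0 ≤ |α| := abs_nonneg α
  have ha1 : 0 ≤ 1 + |α| := by positivity
  -- smoothness of the families and slices
  have hUs : ∀ σ, ContDiff ℝ ∞ (U σ) := fun σ => hU.contDiff_slice (Set.mem_univ σ)
  have hU' : IsSmoothSpaceTimeOn Set.univ V := by
    rw [hV]; exact hU.isSmoothSpaceTimeOn_deriv isOpen_univ
  have hVs : ∀ σ, ContDiff ℝ ∞ (V σ) := fun σ => hU'.contDiff_slice (Set.mem_univ σ)
  have h0 : ∀ τ y, HasDerivAt (fun τ' => U τ' y) (V τ y) τ := by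
    intro τ y
    have h := hU.hasDerivAt_timeLine isOpen_univ (Set.mem_univ τ) y
    rw [hV]; exact h
  have h0' : ∀ τ y, HasDerivAt (fun τ' => V τ' y) (W τ y) τ := by
    intro τ y
    have h := hU'.hasDerivAt_timeLine isOpen_univ (Set.mem_univ τ) y
    rw [hW]; exact h
  -- (8.3) for `U`, orders 0, 1, 2, in `fderiv` form
  have hU0 : ∀ σ y, ‖U σ y‖ ≤ C / (1 + ‖y‖) := by
    intro σ y
    have h := h83 σ 0 (by norm_num) y
    rw [norm_iteratedFDeriv_zero, zero_add, pow_one] at h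
    exact le_div_of_weighted (by positivity) h
  have hU1 : ∀ σ y, ‖fderiv ℝ (U σ) y‖ ≤ C / (1 + ‖y‖) ^ 2 := by
    intro σ y
    have h := h83 σ 1 (by norm_num) y
    have e : ‖iteratedFDeriv ℝ 1 (U σ) y‖ = ‖fderiv ℝ (U σ) y‖ := by
      rw [← norm_iteratedFDeriv_fderiv, norm_iteratedFDeriv_zero]
    rw [e] at h
    exact le_div_of_weighted (by positivity) h
  have hU2 : ∀ σ y, ‖fderiv ℝ (fderiv ℝ (U σ)) y‖ ≤ C / (1 + ‖y‖) ^ 3 := by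
    intro σ y
    have h := h83 σ 2 (by norm_num) y
    have e : ‖iteratedFDeriv ℝ 2 (U σ) y‖ = ‖fderiv ℝ (fderiv ℝ (U σ)) y‖ := by
      rw [← norm_iteratedFDeriv_fderiv, ← norm_iteratedFDeriv_fderiv, norm_iteratedFDeriv_zero]
    rw [e] at h
    exact le_div_of_weighted (by positivity) h
  -- the pressure slices: smooth, and (8.3) for `P` at orders 1..4 in the weighted form
  have hPs : ∀ σ, ContDiff ℝ ∞ (pressurePotential (U σ)) := fun σ =>
    contDiff_pressurePotential_decay_top (hUs σ) (hU0 σ)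
  have hCP : ∀ (k : ℕ) (A : ℝ), 0 ≤ A → k ≤ 3 →
      (∀ (v : EuclideanSpace ℝ (Fin 3) → EuclideanSpace ℝ (Fin 3)) (C' : ℝ), ContDiff ℝ ∞ v →
        (∀ j ≤ (k + 1) + 2, ∀ y, (1 + ‖y‖) ^ (j + 1) * ‖iteratedFDeriv ℝ j v y‖ ≤ C') →
        ∀ x, ‖iteratedFDeriv ℝ (k + 1) (pressurePotential v) x‖ ≤ A * C' ^ 2 / (1 + ‖x‖) ^ ((k + 1) + 2)) →
      ∀ σ y, (1 + ‖y‖) ^ (k + 1) * ‖iteratedFDeriv ℝ (k + 1) (pressurePotential (U σ)) y‖ ≤ A * C ^ 2 := by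
    intro k A hA0 hk hAk σ y
    have h := hAk (U σ) C (hUs σ) (fun j hj y => h83 σ j (by omega) y) y
    have hw : 0 < 1 + ‖y‖ := by positivity
    have hle : (1 + ‖y‖) ^ (k + 1) * (A * C ^ 2 / (1 + ‖y‖) ^ ((k + 1) + 2)) ≤ A * C ^ 2 := by
      have hq : (1 + ‖y‖) ^ (k + 1) / (1 + ‖y‖) ^ ((k + 1) + 2) ≤ 1 :=
        div_le_one_of_le₀ (pow_le_pow_right₀ (by linarith [norm_nonneg y]) (by omega)) (by positivity)
      calc (1 + ‖y‖) ^ (k + 1) * (A * C ^ 2 / (1 + ‖y‖) ^ ((k + 1) + 2))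
          = A * C ^ 2 * ((1 + ‖y‖) ^ (k + 1) / (1 + ‖y‖) ^ ((k + 1) + 2)) := by ring
        _ ≤ A * C ^ 2 * 1 := mul_le_mul_of_nonneg_left hq (by positivity)
        _ = A * C ^ 2 := mul_one _
    exact (mul_le_mul_of_nonneg_left h (by positivity)).trans hle
  have hCP0 := hCP 0 A₁ hA₁0 (by norm_num) hA₁
  have hCP1 := hCP 1 A₂ hA₂0 (by norm_num) hA₂
  have hCP2 := hCP 2 A₃ hA₃0 (by norm_num) hA₃
  have hCP3 := hCP 3 A₄ hA₄0 (by norm_num) hA₄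
  -- the first display at orders 0..3
  have hV0w : ∀ σ y, ‖iteratedFDeriv ℝ 0 (V σ) y‖ ≤ (1 + |α|) * e₀ / (1 + ‖y‖) ^ (0 + 1) := by
    intro σ y; rw [he₀]
    exact norm_iteratedFDeriv_sliceDeriv_le_of_slice_equation 0 (hUs σ) (hPs σ)
      (fun j hj y => h83 σ j (by omega) y) (hCP0 σ) (heq σ) y
  have hV1w : ∀ σ y, ‖iteratedFDeriv ℝ 1 (V σ) y‖ ≤ (1 + |α|) * e₁ / (1 + ‖y‖) ^ (1 + 1) := by
    intro σ y; rw [he₁]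
    exact norm_iteratedFDeriv_sliceDeriv_le_of_slice_equation 1 (hUs σ) (hPs σ)
      (fun j hj y => h83 σ j (by omega) y) (hCP1 σ) (heq σ) y
  have hV2w : ∀ σ y, ‖iteratedFDeriv ℝ 2 (V σ) y‖ ≤ (1 + |α|) * e₂ / (1 + ‖y‖) ^ (2 + 1) := by
    intro σ y; rw [he₂]
    exact norm_iteratedFDeriv_sliceDeriv_le_of_slice_equation 2 (hUs σ) (hPs σ)
      (fun j hj y => h83 σ j (by omega) y) (hCP2 σ) (heq σ) y
  have hV3w : ∀ σ y, ‖iteratedFDeriv ℝ 3 (V σ) y‖ ≤ (1 + |α|) * e₃ / (1 + ‖y‖) ^ (3 + 1) := by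
    intro σ y; rw [he₃]
    exact norm_iteratedFDeriv_sliceDeriv_le_of_slice_equation 3 (hUs σ) (hPs σ)
      (fun j hj y => h83 σ j (by omega) y) (hCP3 σ) (heq σ) y
  -- `fderiv` forms
  have hV0 : ∀ σ y, ‖V σ y‖ ≤ (1 + |α|) * e₀ / (1 + ‖y‖) := by
    intro σ y; have h := hV0w σ y
    rw [norm_iteratedFDeriv_zero, zero_add, pow_one] at h; exact h
  have hV1 : ∀ σ y, ‖fderiv ℝ (V σ) y‖ ≤ (1 + |α|) * e₁ / (1 + ‖y‖) ^ 2 := by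
    intro σ y; have h := hV1w σ y
    have e : ‖iteratedFDeriv ℝ 1 (V σ) y‖ = ‖fderiv ℝ (V σ) y‖ := by
      rw [← norm_iteratedFDeriv_fderiv, norm_iteratedFDeriv_zero]
    rw [e] at h; exact h
  have hV2 : ∀ σ y, ‖fderiv ℝ (fderiv ℝ (V σ)) y‖ ≤ (1 + |α|) * e₂ / (1 + ‖y‖) ^ 3 := by
    intro σ y; have h := hV2w σ y
    have e : ‖iteratedFDeriv ℝ 2 (V σ) y‖ = ‖fderiv ℝ (fderiv ℝ (V σ)) y‖ := by
      rw [← norm_iteratedFDeriv_fderiv, ← norm_iteratedFDeriv_fderiv, norm_iteratedFDeriv_zero]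
    rw [e] at h; exact h
  -- a common weighted bound for `V` up to order 3 (input of the second display at `k = 1`)
  have hVE : ∀ σ, ∀ j ≤ 3, ∀ y, (1 + ‖y‖) ^ (j + 1) * ‖iteratedFDeriv ℝ j (V σ) y‖ ≤
      (1 + |α|) * (e₀ + e₁ + e₂ + e₃) := by
    intro σ j hj y
    interval_cases j
    · exact (weighted_of_le_div (by positivity) (hV0w σ y)).trans
        (mul_le_mul_of_nonneg_left (by linarith) ha1)
    · exact (weighted_of_le_div (by positivity) (hV1w σ y)).trans
        (mul_le_mul_of_nonneg_left (by linarith) ha1)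
    · exact (weighted_of_le_div (by positivity) (hV2w σ y)).trans
        (mul_le_mul_of_nonneg_left (by linarith) ha1)
    · exact (weighted_of_le_div (by positivity) (hV3w σ y)).trans
        (mul_le_mul_of_nonneg_left (by linarith) ha1)
  -- the second display at `k = 1`: `|∇∂ₛP| = 2|D Qˢ[V,U]| ≤ 2 B₁ E_V C (1+|y|)⁻³`
  have hQs : ∀ σ, ContDiff ℝ ∞ (pressurePotentialSym (V σ) (U σ)) := by
    intro σ
    have hp := contDiff_pressurePotential_decay_top ((hVs σ).add (hUs σ)) (C' := (1 + |α|) * e₀ + C)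
      fun y => by
        rw [add_div]
        exact (norm_add_le (V σ y) (U σ y)).trans (add_le_add (hV0 σ y) (hU0 σ y))
    have hm := contDiff_pressurePotential_decay_top ((hVs σ).sub (hUs σ)) (C' := (1 + |α|) * e₀ + C)
      fun y => by
        rw [add_div]
        exact (norm_sub_le (V σ y) (U σ y)).trans (add_le_add (hV0 σ y) (hU0 σ y))
    have he : pressurePotentialSym (V σ) (U σ) =
        fun y => 4⁻¹ * (pressurePotential (V σ + U σ) y - pressurePotential (V σ - U σ) y) := by
      funext y
      rw [pressurePotential_add_sub ((hVs σ).of_le (by norm_cast)) ((hUs σ).of_le (by norm_cast))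
        (hV0 σ) (hU0 σ) y]
      ring
    rw [he]
    exact contDiff_const.mul (hp.sub hm)
  have hDP : ∀ σ y, ‖gradient (fun y => 2 * pressurePotentialSym (V σ) (U σ) y) y‖ ≤
      2 * B₁ * ((1 + |α|) * (e₀ + e₁ + e₂ + e₃)) * C / (1 + ‖y‖) := by
    intro σ y
    have hd : DifferentiableAt ℝ (pressurePotentialSym (V σ) (U σ)) y :=
      ((hQs σ).differentiable (by simp)).differentiableAt
    have hg : gradient (fun y => 2 * pressurePotentialSym (V σ) (U σ) y) y =
        (InnerProductSpace.toDual ℝ (EuclideanSpace ℝ (Fin 3))).symm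
          ((2 : ℝ) • fderiv ℝ (pressurePotentialSym (V σ) (U σ)) y) := by
      rw [gradient, fderiv_const_mul hd]
    rw [hg, LinearIsometryEquiv.norm_map, norm_smul, Real.norm_eq_abs, abs_of_pos two_pos]
    have h := hB₁ (V σ) (U σ) ((1 + |α|) * (e₀ + e₁ + e₂ + e₃)) C (hVs σ) (hUs σ) (hVE σ)
      (fun j hj y => h83 σ j (by omega) y) y
    have hw : 0 < 1 + ‖y‖ := by positivity
    have hnum : 0 ≤ B₁ * ((1 + |α|) * (e₀ + e₁ + e₂ + e₃)) * C := by positivity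
    calc 2 * ‖fderiv ℝ (pressurePotentialSym (V σ) (U σ)) y‖
        ≤ 2 * (B₁ * ((1 + |α|) * (e₀ + e₁ + e₂ + e₃)) * C / (1 + ‖y‖) ^ 3) :=
          mul_le_mul_of_nonneg_left h (by norm_num)
      _ ≤ 2 * (B₁ * ((1 + |α|) * (e₀ + e₁ + e₂ + e₃)) * C / (1 + ‖y‖)) := by
          refine mul_le_mul_of_nonneg_left (div_le_div_of_nonneg_left hnum hw ?_) (by norm_num)
          nlinarith [norm_nonneg y, sq_nonneg ‖y‖, mul_nonneg (norm_nonneg y) (sq_nonneg ‖y‖)]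
      _ = 2 * B₁ * ((1 + |α|) * (e₀ + e₁ + e₂ + e₃)) * C / (1 + ‖y‖) := by ring
  -- `∂ₛ` applied to the equation
  have hone : ∀ y : EuclideanSpace ℝ (Fin 3), C / (1 + ‖y‖) ≤ C := fun y =>
    div_le_self hC0 (by linarith [norm_nonneg y])
  have hK : ∀ σ y, ‖U σ y‖ ≤ C ∧ ‖fderiv ℝ (U σ) y‖ ≤ C ∧ ‖fderiv ℝ (fderiv ℝ (U σ)) y‖ ≤ C :=
    fun σ y => ⟨(hU0 σ y).trans (hone y),
      (hU1 σ y).trans (div_one_add_pow_le_self hC0 (norm_nonneg y) 2),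
      (hU2 σ y).trans (div_one_add_pow_le_self hC0 (norm_nonneg y) 3)⟩
  have hE3 : 0 ≤ (1 + |α|) * (e₀ + e₁ + e₂) := by positivity
  have hK' : ∀ σ y, ‖V σ y‖ ≤ (1 + |α|) * (e₀ + e₁ + e₂) ∧
      ‖fderiv ℝ (V σ) y‖ ≤ (1 + |α|) * (e₀ + e₁ + e₂) ∧
      ‖fderiv ℝ (fderiv ℝ (V σ)) y‖ ≤ (1 + |α|) * (e₀ + e₁ + e₂) := by
    intro σ y
    have hy : 0 ≤ ‖y‖ := norm_nonneg y
    refine ⟨(hV0 σ y).trans ?_, (hV1 σ y).trans ?_, (hV2 σ y).trans ?_⟩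
    · exact (div_le_self (by positivity) (by linarith)).trans
        (mul_le_mul_of_nonneg_left (by linarith) ha1)
    · exact (div_one_add_pow_le_self (by positivity) hy 2).trans
        (mul_le_mul_of_nonneg_left (by linarith) ha1)
    · exact (div_one_add_pow_le_self (by positivity) hy 3).trans
        (mul_le_mul_of_nonneg_left (by linarith) ha1)
  have hds := dslice_equation_of_isSmoothSpaceTimeOn hU hV hW hU0 hV0 hK hK' heq
  -- the third display, `k = 0`
  have hU1' : ∀ σ y, ‖fderiv ℝ (U σ) y‖ ≤ C / (1 + ‖y‖ ^ 2) := fun σ y =>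
    (hU1 σ y).trans (div_le_div_of_nonneg_left hC0 (by positivity)
      (one_add_sq_le_sq_one_add (norm_nonneg y)))
  have hV1' : ∀ σ y, ‖fderiv ℝ (V σ) y‖ ≤ (1 + |α|) * e₁ / (1 + ‖y‖ ^ 2) := fun σ y =>
    (hV1 σ y).trans (div_le_div_of_nonneg_left (by positivity) (by positivity)
      (one_add_sq_le_sq_one_add (norm_nonneg y)))
  have hV2' : ∀ σ y, ‖fderiv ℝ (fderiv ℝ (V σ)) y‖ ≤ (1 + |α|) * e₂ / (1 + ‖y‖ ^ 3) := fun σ y =>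
    (hV2 σ y).trans (div_le_div_of_nonneg_left (by positivity) (by positivity)
      (one_add_cube_le_cube_one_add (norm_nonneg y)))
  have hW0 : ∀ σ y, ‖W σ y‖ ≤ (1 + |α|) * ((1 + |α|) * e₀ + 2 * ((1 + |α|) * e₁) +
      6 * ((1 + |α|) * e₂) + C * ((1 + |α|) * e₀) + C * ((1 + |α|) * e₁) +
        2 * B₁ * ((1 + |α|) * (e₀ + e₁ + e₂ + e₃)) * C) / (1 + ‖y‖) := fun σ y =>
    norm_sliceDeriv2_le_of_dslice_equation ((hVs σ).of_le (by norm_cast)) (hU0 σ) (hU1' σ)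
      (hV0 σ) (hV1' σ) (hV2' σ) (hDP σ) (hds σ) y
  -- assemble
  intro σ y
  refine (hW0 σ y).trans (le_of_eq ?_)
  have hw : (1 + ‖y‖) ≠ 0 := by positivity
  field_simp

end SecondDerivative

end PineauVicol2026

end Literature.Analysis.FluidPDE
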